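import Summits.Schanuel.Schanuel.Theorems.RootDecomp1KNW96Core05

/-!
# RootDecomp1KNW96Core — lens 6, generation 23 «NW96 THEOREM 1, c = 400, HYPOTHESIS-FREE» (PROGRAMME G23-b; VERDICT L2175: THEOREM ×1): `theorem nw1996MainR_400 : NW1996MainR 400` — Nesterenko–Waldschmidt 1996 Theorem 1 (first assertion) with the absolute constant 400 in place of the printed 211, SORRY-FREE, NO hypothesis, NO named fact; = `core` (parts 01–03) + the glue `mainR_of_paramsOK : ParamsOK c → NW1996MainR c` + the audited repair parameters `paramsOK_400` (S = ⌊25UV⌋, S₁ = ⌊9DW+½⌋, T = ⌊33DVW⌋, T₁ = ⌊5U+½⌋, H = ⌊1.1 W log E⌋, ε = E^{−400DUVW}) — continuation (RootDecomp1KNW96Core06): §5 ParamsD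

(lens-6 g23 HOME kernel g23b/NW96Main.lean 5c2fab87…, 2022 l = NW96Core.lean body byte-identical (ported as parts 01–03) + §4–§6; extra imports Literature PiTranscendenceMeasureMain + PiTranscendenceMeasureParams + ExpLogSimultaneousApproximationMeasure (the def `NW1996MainR`, census p828340); NODE L2171 / REQUEST L2172 / ADDENDUM L2174, writer re-check L2173, critic VERDICT L2175 (CLEARED — THEOREM ×1 (G23-b); lens-6 tally THEOREM ×6 + CELL ×3 + AUDIT ×1; RULE G24; PORT GO priority HIGH, Summit-side first; Literature relocation of `nw1996MainR_400` next to the cite-tagged fact = later census pass); port by census-1 gen 18 as `RootDecomp1KNW96Core04`–`07`: 04 = §4 the glue `ParamsOK`, `mainR_of_paramsOK` + §5 ParamsA; 05 = §5 ParamsB + ParamsC; 06 = §5 ParamsD; 07 = §5 ParamsE (`paramsOK_400`, scoped `maxHeartbeats 1000000` as in K) + §6 the headline `nw1996MainR_400`.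
PORT EDITS: `set_option linter.dupNamespace false` and `import HarnessLib` dropped; parts 01–03 untouched; statements and proofs verbatim. `--supports stmt-Schanuel-33364`; no census credit carried; rung 0 — nothing here proves Schanuel. CONSEQUENCE OF RECORD: the registered fact `NesterenkoWaldschmidt1996_thm_1` (constant 211, PRINT-CLAIM · PROOF-GAP per the g22 audit) now has a PROVED weaker-constant companion in the tree; RULE G24 (critic L2175) governs the consumer re-typing generic in c.)
-/

noncomputable section

open Finset

namespace Summit.Schanuel.Schanuel.Theorems.RootDecomp1KNW96Core

open Literature.NumberTheory.Transcendental

section Params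

open Real

section ParamsD

/-! ### D. The budget: numeric constants, the side conditions, the four groups, the row inequality -/

/-- `log x ≤ c/n` from `x^n ≤ 2.718^c`. [folklore] -/
theorem log_le_div_of_pow_le {x : ℝ} (hx : 0 < x) (c n : ℕ) (hn : 0 < n)
    (h : x ^ n ≤ (2.718 : ℝ) ^ c) : log x ≤ (c : ℝ) / n := by
  have hn' : (0 : ℝ) < n := by exact_mod_cast hn
  rw [le_div_iff₀ hn', mul_comm, ← Real.log_pow]
  exact NWPi.log_le_nat_of_le_pow (pow_pos hx n) c h

/-- Numeric logarithms: `log 10.25 ≤ 2.35`, `log 3 ≤ 1.1`, `log 4.3 ≤ 1.47`, `log 4.58 ≤ 1.53`,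
`log 25 ≤ 42/13`, `log 5.5 ≤ 1.71`, `log 397 ≤ 6`, `12/11 ≤ log 3`. [folklore] -/
theorem log_consts :
    log (41 / 4 : ℝ) ≤ 47 / 20 ∧ log (3 : ℝ) ≤ 11 / 10 ∧ log (43 / 10 : ℝ) ≤ 147 / 100 ∧
    log (229 / 50 : ℝ) ≤ 153 / 100 ∧ log (25 : ℝ) ≤ 42 / 13 ∧ log (11 / 2 : ℝ) ≤ 171 / 100 ∧
    log (397 : ℝ) ≤ 6 ∧ 12 / 11 ≤ log (3 : ℝ) := by
  refine ⟨?_, ?_, ?_, ?_, ?_, ?_, ?_, ?_⟩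
  · have := log_le_div_of_pow_le (x := 41 / 4) (by norm_num) 47 20 (by norm_num) (by norm_num)
    norm_num at this; linarith
  · have := log_le_div_of_pow_le (x := 3) (by norm_num) 11 10 (by norm_num) (by norm_num)
    norm_num at this; linarith
  · have := log_le_div_of_pow_le (x := 43 / 10) (by norm_num) 147 100 (by norm_num) (by norm_num)
    norm_num at this; linarith
  · have := log_le_div_of_pow_le (x := 229 / 50) (by norm_num) 153 100 (by norm_num) (by norm_num)
    norm_num at this; linarith
  · have := log_le_div_of_pow_le (x := 25) (by norm_num) 42 13 (by norm_num) (by norm_num)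
    norm_num at this; linarith
  · have := log_le_div_of_pow_le (x := 11 / 2) (by norm_num) 171 100 (by norm_num) (by norm_num)
    norm_num at this; linarith
  · have := NWPi.log_le_nat_of_le_pow (x := 397) (by norm_num) 6 (by norm_num)
    norm_num at this; linarith
  · have := NWPi.div_le_log_of_pow_le (x := 3) 12 11 (by norm_num) (by norm_num)
    norm_num at this; linarith

/-- **Upper bounds for the normalised data**: `U ≤ 1 + 3.3 D log(D+2)`, `V ≤ D lA + 2E max(1,r) + 6`
(`ℓ ≥ 1`). [cite: NesterenkoWaldschmidt1996, §6 (6.9)] -/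
theorem UV_upper {D lA E r ℓ u v U V : ℝ} (hD : 1 ≤ D) (hℓ : 1 ≤ ℓ) (hlA : 1 ≤ D * lA)
    (hE : 2.718 ≤ E) (hr : 0 ≤ r) (hu : u = 33 / 10 * D * log (D + 2) + ℓ)
    (hv : v = D * lA + 2 * E * r + 6 * ℓ) (hU : U = u / ℓ) (hV : V = v / ℓ) :
    U ≤ 1 + 33 / 10 * D * log (D + 2) ∧ V ≤ D * lA + 2 * E * max 1 r + 6 := by
  have hℓ0 : 0 < ℓ := by linarith
  have hl3 : 1 ≤ log (D + 2) :=
    NWPi.one_le_log_three.trans (Real.log_le_log (by norm_num) (by linarith))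
  have hDl : 0 ≤ 33 / 10 * D * log (D + 2) := by
    have : 0 ≤ D * log (D + 2) := mul_nonneg (by linarith) (by linarith)
    linarith
  constructor
  · rw [hU, hu, div_le_iff₀ hℓ0]
    have : 33 / 10 * D * log (D + 2) ≤ 33 / 10 * D * log (D + 2) * ℓ := le_mul_of_one_le_right hDl hℓ
    nlinarith
  · rw [hV, hv, div_le_iff₀ hℓ0]
    have hrp : r ≤ max 1 r := le_max_right _ _
    have hE0 : 0 ≤ E := by linarith
    have h1 : D * lA ≤ D * lA * ℓ := le_mul_of_one_le_right (by linarith) hℓ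
    have h2 : 2 * E * r ≤ 2 * E * max 1 r := by nlinarith
    have h3 : 2 * E * max 1 r ≤ 2 * E * max 1 r * ℓ :=
      le_mul_of_one_le_right (by nlinarith [le_max_left (1 : ℝ) r]) hℓ
    nlinarith

/-- `log U ≤ 1.47 + log D + log log(D+2)`, with `1 ≤ log(D+2) ≤ 1.1 + log D`. [folklore] -/
theorem logU_le {D U : ℝ} (hD : 1 ≤ D) (hU1 : 1 ≤ U) (hU : U ≤ 1 + 33 / 10 * D * log (D + 2)) :
    log U ≤ 147 / 100 + log D + log (log (D + 2)) ∧ 1 ≤ log (D + 2) ∧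
      log (D + 2) ≤ 11 / 10 + log D := by
  have hD0 : 0 < D := by linarith
  have hl3 : 1 ≤ log (D + 2) :=
    NWPi.one_le_log_three.trans (Real.log_le_log (by norm_num) (by linarith))
  have hl0 : 0 < log (D + 2) := by linarith
  have hDl : 1 ≤ D * log (D + 2) := by nlinarith
  have hU' : U ≤ 43 / 10 * (D * log (D + 2)) := by nlinarith
  have h1 : log U ≤ log (43 / 10 * (D * log (D + 2))) := Real.log_le_log (by linarith) hU'
  have h2 : log (43 / 10 * (D * log (D + 2))) = log (43 / 10) + (log D + log (log (D + 2))) := by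
    rw [Real.log_mul (by norm_num) (mul_pos hD0 hl0).ne', Real.log_mul hD0.ne' hl0.ne']
  have h3 : log (D + 2) ≤ log (3 * D) := Real.log_le_log (by linarith) (by linarith)
  rw [Real.log_mul (by norm_num) hD0.ne'] at h3
  refine ⟨by linarith [log_consts.2.2.1], hl3, by linarith [log_consts.2.1]⟩

/-- `log V ≤ 1.53 + log D + log lA + ℓ + log max(1,r)` (`V ≤ 4.58 · D lA · E max(1,r)`).
[cite: NesterenkoWaldschmidt1996, §6 (6.9)] -/
theorem logV_le {D V lA E r ℓ : ℝ} (hD : 1 ≤ D) (hV0 : 0 < V) (hV : V ≤ D * lA + 2 * E * max 1 r + 6)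
    (hlA : 1 ≤ D * lA) (hlA0 : 0 < lA) (hE : 2.718 ≤ E) (hℓ : ℓ = log E) :
    log V ≤ 153 / 100 + log D + log lA + ℓ + log (max 1 r) := by
  have hD0 : 0 < D := by linarith
  have hE0 : 0 < E := by linarith
  have hrp : 1 ≤ max 1 r := le_max_left _ _
  have hrp0 : 0 < max 1 r := by linarith
  have hb : 2.718 ≤ E * max 1 r := by nlinarith
  have ha0 : 0 < D * lA := by linarith
  have hb0 : 0 < E * max 1 r := by linarith
  have hkey : D * lA + 2 * E * max 1 r + 6 ≤ 229 / 50 * ((D * lA) * (E * max 1 r)) := by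
    have h1 : 0 ≤ (D * lA - 1) * (229 / 50 * (E * max 1 r) - 1) := mul_nonneg (by linarith) (by linarith)
    nlinarith
  have h2 : log V ≤ log (229 / 50 * ((D * lA) * (E * max 1 r))) := Real.log_le_log hV0 (hV.trans hkey)
  have h3 : log (229 / 50 * ((D * lA) * (E * max 1 r))) =
      log (229 / 50) + ((log D + log lA) + (log E + log (max 1 r))) := by
    rw [Real.log_mul (by norm_num) (mul_pos ha0 hb0).ne', Real.log_mul ha0.ne' hb0.ne',
      Real.log_mul hD0.ne' hlA0.ne', Real.log_mul hE0.ne' hrp0.ne']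
  rw [hℓ]
  linarith [log_consts.2.2.2.1]

/-- `H > 0`, `Wℓ ≤ H`, and `0 ≤ log(1 + S₁/H) ≤ 2.35 + log D` (`S₁/H ≤ 9D + ¼`).
[cite: NesterenkoWaldschmidt1996, §6 (before (6.8)); REPAIR-v2 §4 (H)] -/
theorem lb_le {D W ℓ S₁ H : ℝ} (hD : 1 ≤ D) (hW : 2 ≤ W) (hℓ : 1 ≤ ℓ) (hWℓ : 12 ≤ W * ℓ)
    (hH : 11 / 10 * (W * ℓ) - 1 < H) (hS₁0 : 0 ≤ S₁) (hS₁ : S₁ ≤ 9 * D * W + 1 / 2) :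
    0 < H ∧ W * ℓ ≤ H ∧ 0 ≤ log (1 + S₁ / H) ∧ log (1 + S₁ / H) ≤ 47 / 20 + log D := by
  have hH1 : W * ℓ ≤ H := by linarith
  have hH0 : 0 < H := by linarith
  have hWH : W ≤ H := le_trans (le_mul_of_one_le_right (by linarith) hℓ) hH1
  have h1 : S₁ ≤ (9 * D + 1 / 4) * H := by
    have : S₁ ≤ (9 * D + 1 / 4) * W := by nlinarith
    have h' : (9 * D + 1 / 4) * W ≤ (9 * D + 1 / 4) * H := mul_le_mul_of_nonneg_left hWH (by linarith)
    linarith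
  have h2 : S₁ / H ≤ 9 * D + 1 / 4 := by rw [div_le_iff₀ hH0]; exact h1
  have hx : 0 ≤ S₁ / H := by positivity
  have h3 : log (1 + S₁ / H) ≤ log (41 / 4 * D) := Real.log_le_log (by linarith) (by linarith)
  rw [Real.log_mul (by norm_num) (by linarith : D ≠ 0)] at h3
  exact ⟨hH0, hH1, Real.log_nonneg (by linarith), by linarith [log_consts.1]⟩

/-- `log(1 + E S₁/H) ≤ log E + log(1 + S₁/H)` for `E ≥ 1`. [folklore] -/
theorem lbE_le {E S₁ H : ℝ} (hE : 1 ≤ E) (hH : 0 < H) (hS₁ : 0 ≤ S₁) :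
    log (1 + E * S₁ / H) ≤ log E + log (1 + S₁ / H) := by
  have hx : 0 ≤ S₁ / H := by positivity
  rw [← Real.log_mul (by linarith) (by linarith)]
  apply Real.log_le_log (by positivity)
  rw [mul_div_assoc]
  nlinarith

/-- **The side condition of the `T`-group**: `3.35 + log D ≤ 3.3 log(D+2)` for `D ≥ 1`.
[cite: NesterenkoWaldschmidt1996, §6 (6.8); REPAIR-v2 §4 (ii)] -/
theorem Tside (Dn : ℕ) (hDn : 1 ≤ Dn) : 67 / 20 + log (Dn : ℝ) ≤ 33 / 10 * log ((Dn : ℝ) + 2) := by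
  obtain ⟨hl2, hl2'⟩ := NWPi.log_two_bounds
  obtain ⟨_, hlog3, _, _, _, _, _, hlog3'⟩ := log_consts
  rcases Nat.lt_or_ge Dn 4 with hlt | hge
  · interval_cases Dn
    · norm_num; linarith
    · norm_num
      have h4 : log (4 : ℝ) = 2 * log 2 := by
        rw [show (4 : ℝ) = 2 ^ 2 by norm_num, Real.log_pow]; norm_num
      rw [h4]; linarith
    · norm_num
      have h5 := NWPi.log_five_ge
      linarith
  · have hD' : (4 : ℝ) ≤ Dn := by exact_mod_cast hge
    have hlogD : log (Dn : ℝ) ≤ log ((Dn : ℝ) + 2) := Real.log_le_log (by linarith) (by linarith)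
    have hlog6 : 1.75 ≤ log ((Dn : ℝ) + 2) :=
      NWPi.log_six_ge.trans (Real.log_le_log (by norm_num) (by linarith))
    linarith

/-- **The side condition of the `S`-group**: `log S + log T₁ + log R ≤ W log E − log B + ¼`.
[cite: NesterenkoWaldschmidt1996, §6 (6.9)–(6.10); REPAIR-v2 §4 (iii)] -/
theorem side3 {D U V S T₁ R lA r ℓ : ℝ} (hD : 1 ≤ D) (hU1 : 1 ≤ U)
    (hlogU : log U ≤ 147 / 100 + log D + log (log (D + 2))) (hl3 : 1 ≤ log (D + 2))
    (hl3' : log (D + 2) ≤ 11 / 10 + log D) (hV6 : 6 ≤ V)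
    (hlogV : log V ≤ 153 / 100 + log D + log lA + ℓ + log (max 1 r)) (hℓ : 1 ≤ ℓ) (hS1 : 1 ≤ S)
    (hS : S ≤ 25 * U * V) (hT₁1 : 1 ≤ T₁) (hT₁ : T₁ ≤ 5 * U + 1 / 2) (hR : R = max 1 r + 1) :
    log S + log T₁ + log R ≤ log lA + 4 * log D + 2 * (ℓ + log (max 1 r)) + 10 + 1 / 4 := by
  have hU0 : 0 < U := by linarith
  have hV0 : 0 < V := by linarith
  have hrp : 1 ≤ max 1 r := le_max_left _ _
  have hrp0 : 0 < max 1 r := by linarith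
  have hlogS : log S ≤ 42 / 13 + log U + log V := by
    have h1 : log S ≤ log (25 * U * V) := Real.log_le_log (by linarith) hS
    rw [Real.log_mul (mul_pos (by norm_num) hU0).ne' hV0.ne', Real.log_mul (by norm_num) hU0.ne'] at h1
    linarith [log_consts.2.2.2.2.1]
  have hlogT₁ : log T₁ ≤ 171 / 100 + log U := by
    have h1 : log T₁ ≤ log (11 / 2 * U) := Real.log_le_log (by linarith) (by linarith)
    rw [Real.log_mul (by norm_num) hU0.ne'] at h1
    linarith [log_consts.2.2.2.2.2.1]
  have hlogR : log R ≤ 0.6932 + log (max 1 r) := by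
    have h1 : log R ≤ log (2 * max 1 r) := Real.log_le_log (by rw [hR]; linarith) (by rw [hR]; linarith)
    rw [Real.log_mul (by norm_num) hrp0.ne'] at h1
    linarith [NWPi.log_two_bounds.2]
  have hll : log (log (D + 2)) ≤ 0.37 * log (D + 2) := log_le_mul (by linarith)
  have hlogD : 0 ≤ log D := Real.log_nonneg hD
  linarith

/-- **The side condition of the `log L`-term**: `log L ≤ 1.37 W log E` (`L ≤ 397 DUVW`).
[cite: NesterenkoWaldschmidt1996, §6 (after (6.10)); REPAIR-v2 §4 (iv)] -/
theorem logL_le {D U V W ℓ lA lB r L : ℝ} (hD : 1 ≤ D) (hU1 : 1 ≤ U)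
    (hlogU : log U ≤ 147 / 100 + log D + log (log (D + 2))) (hl3 : 1 ≤ log (D + 2))
    (hl3' : log (D + 2) ≤ 11 / 10 + log D) (hV6 : 6 ≤ V)
    (hlogV : log V ≤ 153 / 100 + log D + log lA + ℓ + log (max 1 r)) (hW : 2 ≤ W) (hℓ : 1 ≤ ℓ)
    (hlB : 0 ≤ lB) (hw : W * ℓ = lB + log lA + 4 * log D + 2 * (ℓ + log (max 1 r)) + 10)
    (hL0 : 0 < L) (hL : L ≤ 397 * (D * U * V * W)) : log L ≤ 137 / 100 * (W * ℓ) := by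
  have hD0 : 0 < D := by linarith
  have hU0 : 0 < U := by linarith
  have hV0 : 0 < V := by linarith
  have hW0 : 0 < W := by linarith
  have hrp0 : 0 ≤ log (max 1 r) := Real.log_nonneg (le_max_left _ _)
  have h1 : log L ≤ log (397 * (D * U * V * W)) := Real.log_le_log hL0 hL
  have h2 : log (397 * (D * U * V * W)) = log 397 + (((log D + log U) + log V) + log W) := by
    rw [Real.log_mul (by norm_num) (by positivity), Real.log_mul (by positivity) hW0.ne',
      Real.log_mul (by positivity) hV0.ne', Real.log_mul hD0.ne' hU0.ne']
  have hll : log (log (D + 2)) ≤ log (D + 2) - 1 := Real.log_le_sub_one_of_pos (by linarith)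
  have hlogW : log W ≤ 0.37 * W := log_le_mul hW0
  have hWle : W ≤ W * ℓ := le_mul_of_one_le_right hW0.le hℓ
  linarith [log_consts.2.2.2.2.2.2.1]

/-- **Group (i)** — the `α`-, `B`- and `θ`-terms: `S₁(T₁+½)(D lA + ½ log B) + r T₁ E S₁ ≤ 55.5 Ψℓ`.
[cite: NesterenkoWaldschmidt1996, §6 (6.7); REPAIR-v2 §4 (i)] -/
theorem group1 {D U V W ℓ lA E r lB' S₁ T₁ : ℝ} (hD : 1 ≤ D) (hU : 1 ≤ U) (hW : 2 ≤ W) (hℓ : 1 ≤ ℓ)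
    (hlA : 0 ≤ D * lA) (hE : 2.718 ≤ E) (hr : 0 ≤ r) (hS₁0 : 0 ≤ S₁) (hS₁ : S₁ ≤ 9 * D * W + 1 / 2)
    (hT₁0 : 0 ≤ T₁) (hT₁ : T₁ ≤ 5 * U + 1 / 2) (hlB0 : 0 ≤ lB') (hlB : lB' ≤ r + 1)
    (hv : V * ℓ = D * lA + 2 * E * r + 6 * ℓ) :
    S₁ * (T₁ + 1 / 2) * (D * lA + 1 / 2 * lB') + r * T₁ * (E * S₁) ≤ 111 / 2 * (D * U * V * W * ℓ) := by
  have hEr : 0 ≤ E * r := by nlinarith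
  have hrE : r ≤ E * r := le_mul_of_one_le_left hr (by linarith)
  have hZ : D * lA + 1 / 2 * lB' + E * r ≤ V * ℓ := by rw [hv]; linarith
  have hZ0 : 0 ≤ D * lA + 1 / 2 * lB' + E * r := by linarith
  have hQ0 : 0 ≤ S₁ * (T₁ + 1 / 2) := by positivity
  have hQ : S₁ * (T₁ + 1 / 2) ≤ (37 / 4 * (D * W)) * (6 * U) := by
    have hDW : 1 * 2 ≤ D * W := mul_le_mul hD hW (by norm_num) (by linarith)
    apply mul_le_mul <;> linarith
  have h1 : S₁ * (T₁ + 1 / 2) * (D * lA + 1 / 2 * lB') + r * T₁ * (E * S₁) ≤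
      S₁ * (T₁ + 1 / 2) * (D * lA + 1 / 2 * lB' + E * r) := by
    have : r * T₁ * (E * S₁) ≤ S₁ * (T₁ + 1 / 2) * (E * r) := by nlinarith
    nlinarith
  have h2 : S₁ * (T₁ + 1 / 2) * (D * lA + 1 / 2 * lB' + E * r) ≤ (37 / 4 * (D * W)) * (6 * U) * (V * ℓ) :=
    mul_le_mul hQ hZ hZ0 (by positivity)
  have e : (37 / 4 * (D * W)) * (6 * U) * (V * ℓ) = 111 / 2 * (D * U * V * W * ℓ) := by ring
  linarith

/-- **Group (ii)** — the `T`-terms: `(D−1)(T + T·lb) + T + T·lbE ≤ 33 Ψℓ` where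
`lb = log(1 + S₁/H) ≤ 2.35 + log D`, `lbE = log(1 + ES₁/H) ≤ ℓ + lb`, using `Tside`.
[cite: NesterenkoWaldschmidt1996, §6 (6.8); REPAIR-v2 §4 (ii)] -/
theorem group2 {D U V W ℓ u T lb lbE : ℝ} (hD : 1 ≤ D) (hV : 6 ≤ V) (hW : 2 ≤ W) (hℓ1 : 1 ≤ ℓ)
    (hu : u = 33 / 10 * D * log (D + 2) + ℓ) (hUu : U * ℓ = u)
    (hTs : 67 / 20 + log D ≤ 33 / 10 * log (D + 2)) (hlb0 : 0 ≤ lb) (hlb : lb ≤ 47 / 20 + log D)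
    (hlbE : lbE ≤ ℓ + lb) (hT0 : 0 ≤ T) (hT : T ≤ 33 * D * V * W) :
    (D - 1) * (T + T * lb) + (T + T * lbE) ≤ 33 * (D * U * V * W * ℓ) := by
  have hD0 : 0 ≤ D := by linarith
  have h0 := mul_le_mul_of_nonneg_left hlbE hT0
  have h1 : (D - 1) * (T + T * lb) + (T + T * lbE) ≤ T * (D * (1 + lb) + ℓ) := by linarith
  have h2 : D * (1 + lb) + ℓ ≤ u := by
    rw [hu]
    have ha := mul_le_mul_of_nonneg_left hlb hD0
    have hb := mul_le_mul_of_nonneg_left hTs hD0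
    linarith
  have hst0 : 0 ≤ D * (1 + lb) + ℓ := by positivity
  have h3 : T * (D * (1 + lb) + ℓ) ≤ (33 * D * V * W) * u := mul_le_mul hT h2 hst0 (by positivity)
  have e : (33 * D * V * W) * u = 33 * (D * U * V * W * ℓ) := by rw [← hUu]; ring
  linarith

/-- **Group (iii)** — the `S log`-terms: `(D−1)(S log T₁ + S log S) + S log S + S log(RT₁) + S·D lB
≤ 25 DUV(Wℓ + ¼) ≤ 28.125 Ψℓ`. [cite: NesterenkoWaldschmidt1996, §6 (6.10); REPAIR-v2 §4 (iii)] -/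
theorem group3 {D U V W ℓ lA lB S T₁ R r : ℝ} (hD : 1 ≤ D) (hU : 1 ≤ U) (hV : 6 ≤ V) (hW : 2 ≤ W)
    (hℓ : 1 ≤ ℓ) (hS0 : 1 ≤ S) (hS : S ≤ 25 * U * V) (hT₁ : 1 ≤ T₁) (hR1 : 1 ≤ R) (hlB : 0 ≤ lB)
    (hw : W * ℓ = lB + log lA + 4 * log D + 2 * (ℓ + log (max 1 r)) + 10)
    (hside : log S + log T₁ + log R ≤ log lA + 4 * log D + 2 * (ℓ + log (max 1 r)) + 10 + 1 / 4) :
    (D - 1) * (S * log T₁ + S * log S) + (S * log S + S * log (R * T₁)) + S * (D * lB) ≤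
      225 / 8 * (D * U * V * W * ℓ) := by
  have hlogR : 0 ≤ log R := Real.log_nonneg hR1
  have hlogS : 0 ≤ log S := Real.log_nonneg hS0
  have hlogT : 0 ≤ log T₁ := Real.log_nonneg hT₁
  have hS0' : 0 ≤ S := by linarith
  have hD0 : 0 ≤ D := by linarith
  rw [Real.log_mul (by linarith) (by linarith)]
  have hZ : lB + log S + log T₁ + log R ≤ W * ℓ + 1 / 4 := by rw [hw]; linarith
  have hZ0 : 0 ≤ lB + log S + log T₁ + log R := by linarith
  have hnn : 0 ≤ (D - 1) * S * log R := mul_nonneg (mul_nonneg (by linarith) hS0') hlogR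
  have h1 : (D - 1) * (S * log T₁ + S * log S) + (S * log S + S * (log R + log T₁)) + S * (D * lB) ≤
      D * (S * (lB + log S + log T₁ + log R)) := by linarith
  have h2 : S * (lB + log S + log T₁ + log R) ≤ (25 * U * V) * (W * ℓ + 1 / 4) :=
    mul_le_mul hS hZ hZ0 (by positivity)
  have h3 : D * (S * (lB + log S + log T₁ + log R)) ≤ D * ((25 * U * V) * (W * ℓ + 1 / 4)) :=
    mul_le_mul_of_nonneg_left h2 hD0
  have hA : 2 * (D * U * V) ≤ D * U * V * W := by
    have := mul_le_mul_of_nonneg_left hW (by positivity : 0 ≤ D * U * V); linarith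
  have hB : D * U * V * W ≤ D * U * V * W * ℓ := le_mul_of_one_le_right (by positivity) hℓ
  have e : D * ((25 * U * V) * (W * ℓ + 1 / 4)) = 25 * (D * U * V * W * ℓ) + 25 / 4 * (D * U * V) := by
    ring
  linarith

/-- **Group (iv)** — the `H`-, `log 2`-, `log L`- and `S log E`-terms:
`D(1.15 S H + H) + log 2 + D log L + Sℓ ≤ 44.54 Ψℓ + log 2`.
[cite: NesterenkoWaldschmidt1996, §6 (6.11); REPAIR-v2 §4 (iv)] -/
theorem group4 {D U V W ℓ S H L : ℝ} (hD : 1 ≤ D) (hU : 1 ≤ U) (hV : 6 ≤ V) (hW : 2 ≤ W)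
    (hℓ : 1 ≤ ℓ) (_hS0 : 0 ≤ S) (hS : S ≤ 25 * U * V) (hH0 : 0 ≤ H) (hH : H ≤ 11 / 10 * (W * ℓ))
    (hlogL : log L ≤ 137 / 100 * (W * ℓ)) :
    (D - 1) * (S * (23 / 20 * H) + H) + (S * (23 / 20 * H) + H) + log 2 + D * log L + S * ℓ ≤
      4454 / 100 * (D * U * V * W * ℓ) + 0.6932 := by
  have hD0 : 0 ≤ D := by linarith
  have hU0 : 0 ≤ U := by linarith
  have hV0 : 0 ≤ V := by linarith
  have hW0 : 0 ≤ W := by linarith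
  have hℓ0 : 0 ≤ ℓ := by linarith
  have hWℓ0 : 0 ≤ W * ℓ := by positivity
  have hP0 : 0 ≤ D * U * V * W * ℓ := by positivity
  have hUV : 1 * 6 ≤ U * V := mul_le_mul hU hV (by norm_num) hU0
  have hDW : 1 * 2 ≤ D * W := mul_le_mul hD hW (by norm_num) hD0
  -- `S H ≤ 25UV · 1.1 Wℓ`
  have h1 : S * H ≤ (25 * U * V) * (11 / 10 * (W * ℓ)) := mul_le_mul hS hH hH0 (by positivity)
  have h1' : D * (S * H) ≤ D * ((25 * U * V) * (11 / 10 * (W * ℓ))) := mul_le_mul_of_nonneg_left h1 hD0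
  -- `D H ≤ 1.1 D Wℓ ≤ (1.1/6) Ψℓ`
  have h2 : D * H ≤ D * (11 / 10 * (W * ℓ)) := mul_le_mul_of_nonneg_left hH hD0
  have h2' : 6 * (D * (W * ℓ)) ≤ D * U * V * W * ℓ := by
    have := mul_le_mul_of_nonneg_left hUV (by positivity : 0 ≤ D * (W * ℓ)); linarith
  -- `S ℓ ≤ 25 UV ℓ ≤ 12.5 Ψℓ`
  have h3 : S * ℓ ≤ (25 * U * V) * ℓ := mul_le_mul_of_nonneg_right hS (by linarith)
  have h3' : 2 * (U * V * ℓ) ≤ D * U * V * W * ℓ := by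
    have := mul_le_mul_of_nonneg_left hDW (by positivity : 0 ≤ U * V * ℓ); linarith
  -- `D log L ≤ 1.37 D Wℓ`
  have h4 : D * log L ≤ D * (137 / 100 * (W * ℓ)) := mul_le_mul_of_nonneg_left hlogL hD0
  have hl2 := NWPi.log_two_bounds.2
  linarith

/-- **The row inequality**: the four groups against `(L−1)/2 · log E` (`L > 330Ψ`, `Ψ ≥ 12`):
`55.5 + 33 + 28.125 + 44.54 = 161.165 < 165`. [cite: NesterenkoWaldschmidt1996, §6 d); REPAIR-v2 §3′] -/
theorem row_lt {P ℓ L G1 G2 G3 G4 : ℝ} (hP : 12 ≤ P) (hℓ : 1 ≤ ℓ) (hL : 330 * P < L)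
    (h1 : G1 ≤ 111 / 2 * (P * ℓ)) (h2 : G2 ≤ 33 * (P * ℓ)) (h3 : G3 ≤ 225 / 8 * (P * ℓ))
    (h4 : G4 ≤ 4454 / 100 * (P * ℓ) + 0.6932) :
    G1 + G2 + G3 + G4 < (L - 1) / 2 * ℓ := by
  have hℓ0 : 0 < ℓ := by linarith
  have ha := mul_lt_mul_of_pos_right hL hℓ0
  have hb := mul_le_mul_of_nonneg_right hP hℓ0.le
  nlinarith

end ParamsD

end Params

end Summit.Schanuel.Schanuel.Theorems.RootDecomp1KNW96Core

end
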